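import Summits.FinalStateConjecture.FinalStateConjecture.Theorems.EIHFluxBalanceInertialRecessionStubSlaving11AnsatzBound

/-!
# Route EIHFluxBalance — `InertialRecession` (E′), line `SketchCleanExcision`:
# compactness inputs of the zoom argument — uniform local Lipschitz bounds near compact sets, the
# compact box of coercive forms, late-time coercivity of the frozen ansatz (slaving stub `stub_slaving`)

Helper file for the crux `stmt-FinalStateConjecture-17403`
(`Summit.FinalStateConjecture.FinalStateConjecture.Theses.EIHFluxBalance.InertialRecession`, E′),
stub `stub_slaving`; companion of `…StubSlaving12JetCalculus` (zooming and the chain rule through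
the Ricci jet function) for the `C²`/`C³` relative Ricci-smallness capstone `…StubSlaving12RelRicci`.

* `exists_uniform_lipschitz_near_isCompact` — a `C¹` map on an open set `Ω ⊇ K` of a proper space,
  `K` compact, is uniformly Lipschitz and bounded on the `r`-balls around the points of `K`
  (`IsCompact.exists_cthickening_subset_open`, bounds on the compact thickening, mean value
  inequality on balls; Teschl 2012, proof of Thm. 2.13);
* `isCompact_coerciveBox`, `coerciveBox_subset_isInvertible` — `{A | ‖A‖ ≤ α, ∀ v, μ‖v‖ ≤ ‖A v‖}`
  is compact (finite dimension) and consists of invertible forms (`μ > 0`): the zoomed jets of the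
  ansatz live in `{0} × (this box) × B̄(0,1) × B̄(0,1)`, inside the open domain of `ricciJet`;
* `eventually_ansatz_coercive_near_hole` — the spacetime-free part of
  `eventually_coercive_near_hole` (`…StubSlaving3Coercive`): eventually in the lab time, on
  `{x⁰ = t, ‖x̲ − ξᵢ(t)‖ ≤ R, rᵢ ≥ r₀}` all painted radii are positive and the ansatz
  `g₀ = η + Σⱼ (boostedKerrBilin (Λⱼ(x⁰)) (x⁰, ξⱼ(x⁰)) Mⱼ aⱼ − η)` is `m/2`-coercive,
  `m = ((1 + 3γ)²(1 + 4|Mᵢ|/r₀))⁻¹` (hole `i` is `m`-coercive, `norm_le_const_mul_norm_boostedKerrBilin`;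
  the other summands are `≤ m/(2N)` since their centres recede, `norm_boostedKerrBilin_sub_minkowski_le`).

Elementary; no definitions, no named facts.
-/

set_option linter.dupNamespace false
set_option maxSynthPendingDepth 3

noncomputable section

open scoped Topology ContDiff BigOperators
open Filter Set Function Metric Literature.Geometry.Lorentzian
  Summit.FinalStateConjecture.FinalStateConjecture.Theorems

namespace Summit.FinalStateConjecture.FinalStateConjecture.Theorems.SublinearIsFree.Slaving

/-! ### Uniform local Lipschitz bounds near a compact set -/

section Lipschitz

variable {P Q : Type*} [NormedAddCommGroup P] [NormedSpace ℝ P] [ProperSpace P]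
  [NormedAddCommGroup Q] [NormedSpace ℝ Q]

/-- **Uniform local Lipschitz data near a compact set.** Let `f` be `C¹` on an open set `Ω` of a
proper real normed space and `K ⊆ Ω` compact. Then there are `r > 0` and `L, B ≥ 0` such that
for every `j' ∈ K` and every `j` with `‖j − j'‖ ≤ r`: `‖f j − f j'‖ ≤ L ‖j − j'‖` and `‖f j‖ ≤ B`
(a closed `r`-thickening of `K` is a compact subset of `Ω`, `IsCompact.exists_cthickening_subset_open`,
on which `f` and `Df` are bounded; mean value inequality on the convex balls). Teschl 2012, proof
of Thm. 2.13. [folklore] -/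
theorem exists_uniform_lipschitz_near_isCompact {f : P → Q} {Ω K : Set P}
    (hΩ : IsOpen Ω) (hf : ContDiffOn ℝ 1 f Ω) (hK : IsCompact K) (hKΩ : K ⊆ Ω) :
    ∃ r : ℝ, 0 < r ∧ ∃ L B : ℝ, 0 ≤ L ∧ 0 ≤ B ∧ ∀ j' ∈ K, ∀ j : P, ‖j - j'‖ ≤ r →
      ‖f j - f j'‖ ≤ L * ‖j - j'‖ ∧ ‖f j‖ ≤ B := by
  obtain ⟨r, hr, hrΩ⟩ := hK.exists_cthickening_subset_open hΩ hKΩ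
  set K' : Set P := cthickening r K with hK'
  have hK'c : IsCompact K' := hK.cthickening
  have hdiff : ∀ y ∈ Ω, DifferentiableAt ℝ f y := fun y hy ↦
    (hf.differentiableOn one_ne_zero y hy).differentiableAt (hΩ.mem_nhds hy)
  have hcontDf : ContinuousOn (fderiv ℝ f) K' :=
    (hf.continuousOn_fderiv_of_isOpen hΩ le_rfl).mono hrΩ
  have hcontf : ContinuousOn f K' := hf.continuousOn.mono hrΩ
  obtain ⟨C₀, hC₀⟩ := hK'c.exists_bound_of_continuousOn hcontDf
  obtain ⟨B₀, hB₀⟩ := hK'c.exists_bound_of_continuousOn hcontf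
  refine ⟨r, hr, max C₀ 0, max B₀ 0, le_max_right _ _, le_max_right _ _, fun j' hj' j hj ↦ ?_⟩
  have hball : closedBall j' r ⊆ K' := closedBall_subset_cthickening hj' r
  have hjb : j ∈ closedBall j' r := mem_closedBall_iff_norm.2 hj
  have hj'b : j' ∈ closedBall j' r := mem_closedBall_self hr.le
  refine ⟨?_, (hB₀ j (hball hjb)).trans (le_max_left _ _)⟩
  exact (convex_closedBall j' r).norm_image_sub_le_of_norm_fderiv_le
    (fun y hy ↦ hdiff y (hrΩ (hball hy)))
    (fun y hy ↦ (hC₀ y (hball hy)).trans (le_max_left _ _)) hj'b hjb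

end Lipschitz

/-! ### The compact box of coercive forms -/

section CoerciveBox

variable {E : Type*} [NormedAddCommGroup E] [NormedSpace ℝ E] [FiniteDimensional ℝ E]

/-- **The box of bounded coercive forms is compact**: `{A | ‖A‖ ≤ α, ∀ v, μ‖v‖ ≤ ‖A v‖}` is closed
and bounded in the finite-dimensional space of bilinear forms. [folklore] -/
theorem isCompact_coerciveBox (α μ : ℝ) :
    IsCompact {A : E →L[ℝ] E →L[ℝ] ℝ | ‖A‖ ≤ α ∧ ∀ v : E, μ * ‖v‖ ≤ ‖A v‖} := by
  have hclosed : IsClosed {A : E →L[ℝ] E →L[ℝ] ℝ | ‖A‖ ≤ α ∧ ∀ v : E, μ * ‖v‖ ≤ ‖A v‖} := by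
    have h1 : IsClosed {A : E →L[ℝ] E →L[ℝ] ℝ | ‖A‖ ≤ α} := isClosed_le continuous_norm continuous_const
    have h2 : IsClosed {A : E →L[ℝ] E →L[ℝ] ℝ | ∀ v : E, μ * ‖v‖ ≤ ‖A v‖} := by
      rw [show {A : E →L[ℝ] E →L[ℝ] ℝ | ∀ v : E, μ * ‖v‖ ≤ ‖A v‖} =
          ⋂ v : E, {A : E →L[ℝ] E →L[ℝ] ℝ | μ * ‖v‖ ≤ ‖A v‖} by ext A; simp]
      exact isClosed_iInter fun v ↦ isClosed_le continuous_const
        ((ContinuousLinearMap.apply ℝ (E →L[ℝ] ℝ) v).continuous.norm)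
    exact h1.inter h2
  refine Metric.isCompact_of_isClosed_isBounded hclosed ?_
  refine (Metric.isBounded_closedBall (x := (0 : E →L[ℝ] E →L[ℝ] ℝ)) (r := α)).subset ?_
  intro A hA
  rw [mem_closedBall_zero_iff]
  exact hA.1

/-- Coercive forms with `μ > 0` are invertible (`MetricCoord.isInvertible_of_nondegenerate`).
[folklore] -/
theorem coerciveBox_subset_isInvertible {α μ : ℝ} (hμ : 0 < μ) :
    {A : E →L[ℝ] E →L[ℝ] ℝ | ‖A‖ ≤ α ∧ ∀ v : E, μ * ‖v‖ ≤ ‖A v‖} ⊆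
      {A : E →L[ℝ] E →L[ℝ] ℝ | A.IsInvertible} := by
  intro A hA
  refine MetricCoord.isInvertible_of_nondegenerate fun v hv ↦ ?_
  have h0 : A v = 0 := ContinuousLinearMap.ext fun w ↦ hv w
  have h1 := hA.2 v
  rw [h0, norm_zero] at h1
  have h2 : ‖v‖ ≤ 0 := by nlinarith [norm_nonneg v]
  exact norm_le_zero_iff.1 h2

end CoerciveBox

/-! ### Late-time coercivity of the frozen ansatz near a hole (no spacetime) -/

/-- **Late-time coercivity of the modulated ansatz near a hole** (the spacetime-free part of
`eventually_coercive_near_hole`). With `m = ((1 + 3γ)²(1 + 4|Mᵢ|/r₀))⁻¹`: eventually in the lab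
time `t`, at every chart point `x` of the slab `{x⁰ = t}` with `‖x̲ − ξᵢ(t)‖ ≤ R` and `rᵢ(x) ≥ r₀`,
every painted radius `rⱼ(x)` is positive and the ansatz is `m/2`-coercive,
`(m/2)‖v‖ ≤ ‖g₀(x)(v, ·)‖`. [folklore] -/
theorem eventually_ansatz_coercive_near_hole {N : ℕ} {M a : Fin N → ℝ}
    {Λ : Fin N → ℝ → lorentzGroup} {ξ : Fin N → ℝ → E3} {γ : ℝ}
    (hγ : ∀ i t, |((Λ i t : E4 ≃L[ℝ] E4) (E4.basisVector 0)) 0| ≤ γ)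
    (hsep : ∀ i j, i ≠ j → Tendsto (fun t ↦ ‖ξ i t - ξ j t‖) atTop atTop)
    (i : Fin N) (R : ℝ) {r₀ : ℝ} (hr₀ : 0 < r₀) :
    ∀ᶠ t in atTop, ∀ x : E4, x 0 = t → ‖E4.spatial x - ξ i t‖ ≤ R →
      r₀ ≤ Kerr.radius (a i) (poincareInv (Λ i t) (E4.ofTimeSpace t (ξ i t)) x) →
      (∀ j, 0 < Kerr.radius (a j) (poincareInv (Λ j t) (E4.ofTimeSpace t (ξ j t)) x)) ∧
      ∀ v : E4, ((1 + 3 * γ) ^ 2 * (1 + 4 * (|M i| / r₀)))⁻¹ / 2 * ‖v‖ ≤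
        ‖(Minkowski.bilin + ∑ j, (boostedKerrBilin (Λ j (x 0)) (E4.ofTimeSpace (x 0)
          (ξ j (x 0))) (M j) (a j) x - Minkowski.bilin)) v‖ := by
  have hN : (0 : ℝ) < N := by exact_mod_cast Fin.pos i
  have hγ1 : 1 ≤ γ := (one_le_abs_lorentz_apply_zero (Λ i 0)).trans (hγ i 0)
  set K : ℝ := (1 + 3 * γ) ^ 2 * (1 + 4 * (|M i| / r₀)) with hK
  have hK1 : 1 ≤ K := by
    have h1 : (1 : ℝ) ≤ (1 + 3 * γ) ^ 2 := by nlinarith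
    have h2 : (1 : ℝ) ≤ 1 + 4 * (|M i| / r₀) := by
      have : 0 ≤ |M i| / r₀ := by positivity
      linarith
    nlinarith
  have hK0 : 0 < K := by linarith
  set m : ℝ := K⁻¹ with hm
  have hm0 : 0 < m := inv_pos.mpr hK0
  set L : ℝ := 8 * N * (1 + 3 * γ) ^ 2 * (∑ j, |M j| + 1) / m with hL
  have hL0 : 0 < L := by positivity
  have E1 : ∀ j, ∀ᶠ t in atTop, j ≠ i → R + (|a j| + L) ≤ ‖ξ i t - ξ j t‖ := by
    intro j
    by_cases hij : j = i
    · exact Eventually.of_forall fun t h ↦ (h hij).elim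
    · exact ((hsep i j (Ne.symm hij)).eventually_ge_atTop _).mono fun t ht _ ↦ ht
  filter_upwards [eventually_all.2 E1] with t ht1 x hx0 hxR hxr
  -- radii of the other holes
  have hradius : ∀ j, j ≠ i →
      L ≤ Kerr.radius (a j) (poincareInv (Λ j t) (E4.ofTimeSpace t (ξ j t)) x) := by
    intro j hij
    have hfar : |a j| + L ≤ ‖E4.spatial x - ξ j t‖ := by
      have htri : ‖ξ i t - ξ j t‖ ≤ ‖E4.spatial x - ξ i t‖ + ‖E4.spatial x - ξ j t‖ := by
        calc ‖ξ i t - ξ j t‖ = ‖(E4.spatial x - ξ j t) - (E4.spatial x - ξ i t)‖ := by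
              congr 1; abel
          _ ≤ ‖E4.spatial x - ξ j t‖ + ‖E4.spatial x - ξ i t‖ := norm_sub_le _ _
          _ = _ := add_comm _ _
      linarith [ht1 j hij]
    exact le_radius_poincareInv_of_le (Λ j t) (a j) t (ξ j t) hx0 hL0.le hfar
  have hrpos : ∀ j, 0 < Kerr.radius (a j) (poincareInv (Λ j t) (E4.ofTimeSpace t (ξ j t)) x) := by
    intro j
    by_cases hij : j = i
    · subst hij; exact hr₀.trans_le hxr
    · exact hL0.trans_le (hradius j hij)
  -- (1) hole `i` is `m`-coercive at `x`
  have hcoer : ∀ v : E4, m * ‖v‖ ≤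
      ‖boostedKerrBilin (Λ i t) (E4.ofTimeSpace t (ξ i t)) (M i) (a i) x v‖ := by
    intro v
    rw [hm, inv_mul_le_iff₀ hK0]
    exact norm_le_const_mul_norm_boostedKerrBilin (Λ i t) _ (M i) (a i) (hγ i t) hr₀ hxr v
  -- (2) the other summands are small at `x`
  have hcross : ∀ j, j ≠ i →
      ‖boostedKerrBilin (Λ j t) (E4.ofTimeSpace t (ξ j t)) (M j) (a j) x - Minkowski.bilin‖ ≤
        m / (2 * N) := by
    intro j hij
    have hrL := hradius j hij
    have hrp := hrpos j
    have h1 := norm_boostedKerrBilin_sub_minkowski_le (Λ j t) (E4.ofTimeSpace t (ξ j t)) (M j)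
      (a j) hrp
    have hH : |Kerr.scalarH (M j) (a j) (poincareInv (Λ j t) (E4.ofTimeSpace t (ξ j t)) x)| ≤
        |M j| / L :=
      (abs_scalarH_le (M j) (a j) hrp).trans (div_le_div_of_nonneg_left (abs_nonneg _) hL0 hrL)
    have hLi : ‖(((Λ j t : E4 ≃L[ℝ] E4).symm : E4 →L[ℝ] E4))‖ ^ 2 ≤ (1 + 3 * γ) ^ 2 :=
      pow_le_pow_left₀ (norm_nonneg _) ((norm_lorentz_symm_le' (Λ j t)).trans (by
        linarith [hγ j t])) 2
    have hMj : |M j| ≤ ∑ k, |M k| + 1 :=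
      (Finset.single_le_sum (fun k _ ↦ abs_nonneg (M k)) (Finset.mem_univ j)).trans (by linarith)
    calc ‖boostedKerrBilin (Λ j t) (E4.ofTimeSpace t (ξ j t)) (M j) (a j) x - Minkowski.bilin‖
        ≤ 4 * (|M j| / L) * (1 + 3 * γ) ^ 2 := h1.trans (by gcongr)
      _ ≤ 4 * ((∑ k, |M k| + 1) / L) * (1 + 3 * γ) ^ 2 := by gcongr
      _ = m / (2 * N) := by
          rw [hL]
          field_simp
          ring
  -- (3) hence the full reference field is `m/2`-coercive at `x`
  have hsum : (Minkowski.bilin + ∑ j, (boostedKerrBilin (Λ j (x 0)) (E4.ofTimeSpace (x 0)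
      (ξ j (x 0))) (M j) (a j) x - Minkowski.bilin)) =
      boostedKerrBilin (Λ i t) (E4.ofTimeSpace t (ξ i t)) (M i) (a i) x +
      ∑ j ∈ Finset.univ.erase i, (boostedKerrBilin (Λ j t) (E4.ofTimeSpace t (ξ j t)) (M j) (a j)
        x - Minkowski.bilin) := by
    rw [hx0, ← Finset.add_sum_erase _ _ (Finset.mem_univ i)]
    abel
  have hE : ‖∑ j ∈ Finset.univ.erase i, (boostedKerrBilin (Λ j t) (E4.ofTimeSpace t (ξ j t)) (M j)
      (a j) x - Minkowski.bilin)‖ ≤ m / 2 := by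
    refine (norm_sum_le (Finset.univ.erase i) fun j ↦ boostedKerrBilin (Λ j t)
      (E4.ofTimeSpace t (ξ j t)) (M j) (a j) x - Minkowski.bilin).trans ?_
    calc ∑ j ∈ Finset.univ.erase i, ‖boostedKerrBilin (Λ j t) (E4.ofTimeSpace t (ξ j t)) (M j)
          (a j) x - Minkowski.bilin‖
        ≤ ∑ j ∈ Finset.univ.erase i, m / (2 * N) :=
          Finset.sum_le_sum fun j hj ↦ hcross j (Finset.ne_of_mem_erase hj)
      _ ≤ ∑ _j : Fin N, m / (2 * N) :=
          Finset.sum_le_sum_of_subset_of_nonneg (Finset.erase_subset _ _)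
            fun _ _ _ ↦ by positivity
      _ = m / 2 := by
          rw [Finset.sum_const, Finset.card_univ, Fintype.card_fin, nsmul_eq_mul]
          field_simp
  refine ⟨hrpos, fun v ↦ ?_⟩
  rw [hsum, show m / 2 = m - m / 2 by ring]
  exact coercive_add_of_norm_le hcoer hE v

/-- **Registered one-line carrier form** (`slaving_ansatz_coercive_near_hole_slaving12`) of
`eventually_ansatz_coercive_near_hole`. [folklore] -/
theorem slaving_ansatz_coercive_near_hole_slaving12 : open Literature.Geometry.Lorentzian Filter in ∀ {N : ℕ} {M a : Fin N → ℝ} {Λ : Fin N → ℝ → lorentzGroup} {ξ : Fin N → ℝ → E3} {γ : ℝ}, (∀ i t, |((Λ i t : E4 ≃L[ℝ] E4) (E4.basisVector 0)) 0| ≤ γ) → (∀ i j, i ≠ j → Tendsto (fun t ↦ ‖ξ i t - ξ j t‖) atTop atTop) → ∀ (i : Fin N) (R : ℝ) {r₀ : ℝ}, 0 < r₀ → ∀ᶠ t in atTop, ∀ x : E4, x 0 = t → ‖E4.spatial x - ξ i t‖ ≤ R → r₀ ≤ Kerr.radius (a i) (poincareInv (Λ i t) (E4.ofTimeSpace t (ξ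 i t)) x) → (∀ j, 0 < Kerr.radius (a j) (poincareInv (Λ j t) (E4.ofTimeSpace t (ξ j t)) x)) ∧ ∀ v : E4, ((1 + 3 * γ) ^ 2 * (1 + 4 * (|M i| / r₀)))⁻¹ / 2 * ‖v‖ ≤ ‖(Minkowski.bilin + ∑ j, (boostedKerrBilin (Λ j (x 0)) (E4.ofTimeSpace (x 0) (ξ j (x 0))) (M j) (a j) x - Minkowski.bilin)) v‖ :=
  fun hγ hsep i R _ hr₀ ↦ eventually_ansatz_coercive_near_hole hγ hsep i R hr₀

end Summit.FinalStateConjecture.FinalStateConjecture.Theorems.SublinearIsFree.Slaving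

end
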